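import Summits.QuantumFields.YangMills.Theorems.UnitScaleTiltProp7TwistedLevelMassT3
import Summits.QuantumFields.YangMills.Theorems.UnitScaleTiltProp7JointRowTowerData
import HarnessLib

/-!
# Route `UnitScaleTilt`, crux K1 «MinimiserStabilityRegPr» (stmt-QuantumFields-19200), route-R E′ (A′) «HCOW-VIA-Σ», row P-A2 «JOINT-Σ», file F3″-MEMBER —
# THE TWISTED LEVEL MASSES AT THE Σ∕E2E DATUM: `W ∈ 𝔘_k(e)` printed-regular, direction `D` Hermitian traceless with `‖D(b)‖ ≤ s`, competitor `e^{iD}W`;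
# NO (n3) binder left — `∀ l < K − n, Σ_b ‖log(V^{(l)}(b)·W̄^{(l)}(b)⁻¹)‖² ≤ cA·M₀·L^{−l} + (cB·(CURL + DIV) + cB′·ℓ⁻²·M₀)·Lˡ` with L-only `cA cB cB′`

Cell `ym3-torus`, width seat `ym3-torus-px17` (gen 3); follow-up of ✓p694806 (F3″-C3).  THE POINT.  ✓ `Prop7TwistedLevelMassT3.twistedLevelMass_hM_log_T3` carries (n3)'s binders
(`hU μ hμ0 hμ hμ72 hμN θ hμθ hθL` of ✓ `Prop7FibreLevelMassPerLevelT3.sum_normSq_levelRatio_le_LOnly_T3`); at the E2E datum they are inhabited BY NAME by ✓ `Prop7JointRowTowerData`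
(`chartSups`: `μ_j := 480L⁴Lʲs`; `supNumerals`: `θ := 3744000L⁷(ℓs)`, windows `10¹⁴L⁹e ≤ 1`, `4·10¹¹L⁹(ℓs) ≤ 1`), exactly as ✓ `Prop7JointRowOfSuppliers.jointRow_of_suppliers` feeds (n3) for
the untwisted JOINT row.  This file is that knit for the TWISTED tower `V^{(l)} = dbarCovIterU l W♭ (e^{iD}W)♭` against `W̄^{(l)} = emlIterU l W♭` (`♭ = unitsField ∘ toUField`): the
`hM` hypothesis of ✓ `Prop7JointRowOfLevelMasses.jointRow_currency` ∕ ✓ `…Q.jointRow_currency_q` in F1″-COV's log currency AT THE MEMBER (§2), its `‖· − 1‖` twin, and the frame facts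
(special unitary, sup `≤ 2·480L⁴Lˡs`) at the member (§1).  THEOREMS ONLY (0 `def`, 0 `sorry`); `--supports stmt-QuantumFields-19200`, count-neutral.  YM₃ on T³ is a ladder rung (R3), not the
Clay problem; nothing here claims the stub, the crux, d = 4 or the gap.

References: T. Bałaban, CMP 98 (1985) 17–51 [Balaban1985Averaging] ((89) p.31, (97) p.32, Prop. 3 (122)–(126) p.36, Prop. 4 (134)–(135) p.38); CMP 95 (1984) 17–40 [Balaban1984PropagatorsI]
((1.18)–(1.20) pp.19–20); CMP 102 (1985) 277–309 [Balaban1985Variational] ((2), (6) p.278, (14)–(15) p.280, Prop. 7 p.299).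
-/

set_option autoImplicit false

noncomputable section

open scoped BigOperators Matrix.Norms.L2Operator Matrix

namespace Summit.QuantumFields.YangMills.Theorems.Prop7TwistedLevelMassOfRegPr

open Literature.MathematicalPhysics.QuantumFieldTheory.Balaban1983to89
open Literature.MathematicalPhysics.QuantumFieldTheory.Balaban1983to89.T3ContinuumYM3Torus
open Literature.MathematicalPhysics.QuantumFieldTheory.Balaban1983to89.T3RegularMinimiser (regThreshold)
open Literature.MathematicalPhysics.QuantumFieldTheory.Balaban1983to89.T3PrintedRegularMinimiser (RegPr)
open Literature.MathematicalPhysics.QuantumFieldTheory.Balaban1983to89.T3SectALandauChart (emb15)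
open Finset T4Continuum BlockAveraging AveragingRT ExpMeanLog BlockAveragingEMLLinearised BlockAveragingEMLLinearisedBackground
open MatrixLog (mlog)
open B9Eq39Adjoint (curl divB)
open B10Eq27TorusAxialLog (unitsField toUField)
open B9TorusCalculus (torusT)
open Summit.QuantumFields.YangMills.Theorems.Prop7TPrint (expHermField)
open Summit.QuantumFields.YangMills.Theorems.Prop8Chart (emlIterU)
open Summit.QuantumFields.YangMills.Theorems.Prop7SymAvgTwSym (frameAccU dbarCovIterU)
open Summit.QuantumFields.YangMills.Theorems.Prop7JointRowTowerData (chartSups supNumerals)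
open Summit.QuantumFields.YangMills.Theorems.Prop7CompetitorGuardOfLevelSups (small_iter_competitor_T3 small_iter_background_T3')
open Summit.QuantumFields.YangMills.Theorems.Prop7TwistedTowerFramesT3 (frameAccU_su2_and_sup)
open Summit.QuantumFields.YangMills.Theorems.Prop7TwistedLevelMassT3 (twistedLevelMass_hM_log_T3 sum_normSq_twistedLevelRatio_le_LOnly_T3)

variable (F : T3Family) (n K : ℕ)

/-! ## §0 The two seams: the plaquette clause of `RegPr` in (n3)'s letters, and the weak window from the strong one -/

/-- the plaquette clause of print's regular space in (n3)'s letters: `dist1(W(∂p)) ≤ e·((L^{K−n})²)⁻¹` (`regThreshold F n K e = e·(L⁻¹)^{2(K−n)}`).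
[cite: Balaban1985Variational, (2) p.278, (6) p.278, (14) p.280] -/
theorem plaq_le_of_regPr {e : ℝ} {W : GaugeField (F.P K) 0 (Matrix.specialUnitaryGroup (Fin 2) ℂ)} (hreg : RegPr F n K e W) :
    ∀ p : Plaq (F.P K) 0, dist1 (GaugeField.plaqHol W p) ≤ e * ((((F.L : ℝ) ^ (K - n))) ^ 2)⁻¹ := by
  intro p
  have h1 := (hreg.plaqSmall p).le
  have h2 : regThreshold F n K e = e * ((((F.L : ℝ) ^ (K - n))) ^ 2)⁻¹ := by
    rw [regThreshold, inv_pow, ← pow_mul, mul_comm 2 (K - n), pow_mul]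
  rwa [h2] at h1

/-- `10¹⁴L⁹e ≤ 1 ⟹ 10⁶L⁵e ≤ 1` (`0 < e`, `L ≥ 3`). [folklore] -/
theorem window_weak {e : ℝ} (he : 0 < e) (heL : 100000000000000 * (F.L : ℝ) ^ 9 * e ≤ 1) : 1000000 * (F.L : ℝ) ^ 5 * e ≤ 1 := by
  have hL3 : (3 : ℝ) ≤ (F.L : ℝ) := Prop7CurvedLandauKnitT3.three_le_L F
  have hL1 : (1 : ℝ) ≤ (F.L : ℝ) := by linarith
  have h59 : (F.L : ℝ) ^ 5 ≤ (F.L : ℝ) ^ 9 := pow_le_pow_right₀ hL1 (by norm_num)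
  nlinarith [pow_nonneg (by linarith : (0 : ℝ) ≤ F.L) 5, he.le]

/-! ## §1 The accumulated frames at the member: special unitary, sup `≤ 2·480L⁴Lˡs` at every level -/

/-- ★★ **THE ACCUMULATED FRAMES AT THE E2E DATUM**: `W ∈ 𝔘_k(e)`, `D` Hermitian traceless with `‖D(b)‖ ≤ s`, `4s ≤ 1`, windows `10¹⁴L⁹e ≤ 1`, `4·10¹¹L⁹(ℓs) ≤ 1`; then for every
`l ≤ K − n` and every `x`, `v_l(x) := frameAccU l W♭ (e^{iD}W)♭ x ∈ SU(2)` and `‖v_l(x) − 1‖ ≤ 2·(480L⁴·Lˡ·s)` (✓ `frameAccU_su2_and_sup` at `μ_j = ρ_j = 480L⁴Lʲs`, guards by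
✓ `small_iter_background_T3'` ∕ `small_iter_competitor_T3`). [cite: Balaban1985Averaging, (97) p.32, Prop. 3 (122)-(126) p.36, Prop. 4 (134)-(135) p.38] -/
theorem frameAccU_su2_and_sup_of_regPr {e s : ℝ} (he : 0 < e) (heL : 100000000000000 * (F.L : ℝ) ^ 9 * e ≤ 1)
    (hs0 : 0 ≤ s) (hs4 : 4 * s ≤ 1) (hsL : 400000000000 * (F.L : ℝ) ^ 9 * (((F.L : ℝ) ^ (K - n)) * s) ≤ 1)
    {W : GaugeField (F.P K) 0 (Matrix.specialUnitaryGroup (Fin 2) ℂ)} (hreg : RegPr F n K e W)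
    (D : PBond (F.P K) 0 → Matrix (Fin 2) (Fin 2) ℂ) (hD : ∀ b : PBond (F.P K) 0, (D b).IsHermitian ∧ Matrix.trace (D b) = 0)
    (hs : ∀ b : PBond (F.P K) 0, ‖D b‖ ≤ s) :
    ∀ l, l ≤ K - n →
      (∀ x : Site (F.P K) l, ((frameAccU l (unitsField (toUField W)) (unitsField (toUField (emb15 W (expHermField D)))) x : (Matrix (Fin 2) (Fin 2) ℂ)ˣ) : Matrix (Fin 2) (Fin 2) ℂ)
          ∈ Matrix.specialUnitaryGroup (Fin 2) ℂ) ∧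
      (∀ x : Site (F.P K) l, ‖((frameAccU l (unitsField (toUField W)) (unitsField (toUField (emb15 W (expHermField D)))) x : (Matrix (Fin 2) (Fin 2) ℂ)ˣ) : Matrix (Fin 2) (Fin 2) ℂ) - 1‖
          ≤ 2 * (480 * (F.L : ℝ) ^ 4 * (F.L : ℝ) ^ l * s)) := by
  have hL3 : (3 : ℝ) ≤ (F.L : ℝ) := Prop7CurvedLandauKnitT3.three_le_L F
  have hL0 : (0 : ℝ) < F.L := by linarith
  have heL' := window_weak F he heL
  have hUe := plaq_le_of_regPr F n K hreg
  obtain ⟨-, hμ⟩ := chartSups F n K he heL hs0 hs4 hsL hreg D hD hs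
  obtain ⟨-, hμ0, hμ72, hμN, hμθ, hθ0, hθL⟩ := supNumerals F n K hs0 hsL
  have hU₀g := small_iter_background_T3' F n K W he heL' hUe
  have hWg := small_iter_competitor_T3 F n K W (emb15 W (expHermField D)) he heL' hUe (fun j : ℕ => 480 * (F.L : ℝ) ^ 4 * (F.L : ℝ) ^ j * s) hμ0 hμ hμ72 hμN
  have h := frameAccU_su2_and_sup F n K W (emb15 W (expHermField D)) hU₀g hWg (fun j : ℕ => 480 * (F.L : ℝ) ^ 4 * (F.L : ℝ) ^ j * s) hμ hμ72 hθ0 hμθ hθL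
  intro l hl
  obtain ⟨hsu, hsup⟩ := h l hl
  refine ⟨hsu, fun x => (hsup x).trans (le_of_eq ?_)⟩
  -- `ρ_l = θLˡ∕(7800L³ℓ) = 480L⁴Lˡs` at `θ = 3744000L⁷(ℓs)`
  have hℓ : ((F.L : ℝ) ^ (K - n)) ≠ 0 := by positivity
  field_simp
  ring

/-! ## §2 ★★★ The twisted level masses at the member, in the `hM` shape of ✓ `jointRow_currency` -/

/-- ★★★ **THE TWISTED LEVEL MASSES AT THE Σ∕E2E DATUM, LOG CURRENCY, `hM` SHAPE**: `W ∈ 𝔘_k(e)` (`RegPr F n K e W`), `D` Hermitian traceless with `‖D(b)‖ ≤ s`, `4s ≤ 1`,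
windows `10¹⁴L⁹e ≤ 1`, `4·10¹¹L⁹(ℓs) ≤ 1`.  Then for every `l < K − n`, with `V^{(l)} = dbarCovIterU l W♭ (e^{iD}W)♭`, `W̄^{(l)} = emlIterU l W♭`, `M₀ = Σ‖pertVar W (e^{iD}W)‖²`,
`KD = CURL + DIV` ((n3)'s letters at `(W, e^{iD}W)`): `Σ_b ‖log(V^{(l)}(b)·W̄^{(l)}(b)⁻¹)‖² ≤ cA·M₀·(Lˡ)⁻¹ + (cB·KD + cB′·1·((L^{K−n})²)⁻¹·M₀)·Lˡ`,
`cA = 4(21 + 10080L³)`, `cB = 4(3 + 720L²)·28800L⁴`, `cB′ = 4(3 + 720L²)·600000L⁴` — ✓ `twistedLevelMass_hM_log_T3` ∘ ✓ `chartSups` ∘ ✓ `supNumerals`, no (n3) binder left.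
[cite: Balaban1985Averaging, (89) p.31, (97) p.32, Prop. 3 (122)-(126) p.36, Prop. 4 (134)-(135) p.38; Balaban1984PropagatorsI, (1.18)-(1.20) pp.19-20; Balaban1985Variational, (14)-(15) p.280, Prop. 7 p.299] -/
theorem twistedLevelMass_hM_log_of_regPr {e s : ℝ} (he : 0 < e) (heL : 100000000000000 * (F.L : ℝ) ^ 9 * e ≤ 1)
    (hs0 : 0 ≤ s) (hs4 : 4 * s ≤ 1) (hsL : 400000000000 * (F.L : ℝ) ^ 9 * (((F.L : ℝ) ^ (K - n)) * s) ≤ 1)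
    {W : GaugeField (F.P K) 0 (Matrix.specialUnitaryGroup (Fin 2) ℂ)} (hreg : RegPr F n K e W)
    (D : PBond (F.P K) 0 → Matrix (Fin 2) (Fin 2) ℂ) (hD : ∀ b : PBond (F.P K) 0, (D b).IsHermitian ∧ Matrix.trace (D b) = 0)
    (hs : ∀ b : PBond (F.P K) 0, ‖D b‖ ≤ s) :
    ∀ l < K - n, ∑ b : PBond (F.P K) l, ‖mlog (((dbarCovIterU l (unitsField (toUField W)) (unitsField (toUField (emb15 W (expHermField D)))) b
          * (emlIterU l (unitsField (toUField W)) b)⁻¹ : (Matrix (Fin 2) (Fin 2) ℂ)ˣ) : Matrix (Fin 2) (Fin 2) ℂ))‖ ^ 2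
      ≤ (4 * (21 + 10080 * (F.L : ℝ) ^ 3)) * (∑ b : PBond (F.P K) 0, ‖pertVar W (emb15 W (expHermField D)) b‖ ^ 2) * ((F.L : ℝ) ^ l)⁻¹
        + ((4 * (3 + 720 * (F.L : ℝ) ^ 2) * (28800 * (F.L : ℝ) ^ 4)) * ((∑ x : Site (F.P K) 0, ∑ μ : Fin (F.P K).d, ∑ ν : Fin (F.P K).d,
            (if μ < ν then ∑ j : Fin 2, ∑ k : Fin 2,
              ‖(curl (torusT (F.P K) 0) (fun κ z => unitsField (toUField W) ⟨z, κ⟩) (fun κ z => pertVar W (emb15 W (expHermField D)) ⟨z, κ⟩) μ ν x) j k‖ ^ 2 else 0)) + (∑ x : Site (F.P K) 0, ∑ j : Fin 2, ∑ k : Fin 2,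
            ‖(divB (torusT (F.P K) 0) (fun κ z => unitsField (toUField W) ⟨z, κ⟩) (fun κ z => pertVar W (emb15 W (expHermField D)) ⟨z, κ⟩) x) j k‖ ^ 2))
            + (4 * (3 + 720 * (F.L : ℝ) ^ 2) * (600000 * (F.L : ℝ) ^ 4)) * 1 * (((F.L : ℝ) ^ (K - n)) ^ 2)⁻¹ * (∑ b : PBond (F.P K) 0, ‖pertVar W (emb15 W (expHermField D)) b‖ ^ 2)) * (F.L : ℝ) ^ l := by
  have heL' := window_weak F he heL
  have hUe := plaq_le_of_regPr F n K hreg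
  obtain ⟨-, hμ⟩ := chartSups F n K he heL hs0 hs4 hsL hreg D hD hs
  obtain ⟨-, hμ0, hμ72, hμN, hμθ, hθ0, hθL⟩ := supNumerals F n K hs0 hsL
  exact twistedLevelMass_hM_log_T3 F n K W (emb15 W (expHermField D)) he heL' hUe (fun j : ℕ => 480 * (F.L : ℝ) ^ 4 * (F.L : ℝ) ^ j * s) hμ0 hμ hμ72 hμN hθ0 hμθ hθL

/-- ★★ **THE SAME IN THE `‖· − 1‖` CURRENCY, EVERY `l ≤ K − n`** (✓ `sum_normSq_twistedLevelRatio_le_LOnly_T3` at the member):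
`Σ_b ‖V^{(l)}(b)·W̄^{(l)}(b)⁻¹ − 1‖² ≤ (21 + 10080L³)·(M₀(Lˡ)⁻¹) + (3 + 720L²)·((28800L⁴·KD + 600000L⁴·((L^{K−n})²)⁻¹·M₀)·Lˡ)`.
[cite: Balaban1985Averaging, (89) p.31, (97) p.32, Prop. 3 (122)-(126) p.36; Balaban1985Variational, (14)-(15) p.280, Prop. 7 p.299] -/
theorem sum_normSq_twistedLevelRatio_le_of_regPr {e s : ℝ} (he : 0 < e) (heL : 100000000000000 * (F.L : ℝ) ^ 9 * e ≤ 1)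
    (hs0 : 0 ≤ s) (hs4 : 4 * s ≤ 1) (hsL : 400000000000 * (F.L : ℝ) ^ 9 * (((F.L : ℝ) ^ (K - n)) * s) ≤ 1)
    {W : GaugeField (F.P K) 0 (Matrix.specialUnitaryGroup (Fin 2) ℂ)} (hreg : RegPr F n K e W)
    (D : PBond (F.P K) 0 → Matrix (Fin 2) (Fin 2) ℂ) (hD : ∀ b : PBond (F.P K) 0, (D b).IsHermitian ∧ Matrix.trace (D b) = 0)
    (hs : ∀ b : PBond (F.P K) 0, ‖D b‖ ≤ s) :
    ∀ l ≤ K - n, ∑ b : PBond (F.P K) l, ‖((dbarCovIterU l (unitsField (toUField W)) (unitsField (toUField (emb15 W (expHermField D)))) b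
          * (emlIterU l (unitsField (toUField W)) b)⁻¹ : (Matrix (Fin 2) (Fin 2) ℂ)ˣ) : Matrix (Fin 2) (Fin 2) ℂ) - 1‖ ^ 2
      ≤ (21 + 10080 * (F.L : ℝ) ^ 3) * ((∑ b : PBond (F.P K) 0, ‖pertVar W (emb15 W (expHermField D)) b‖ ^ 2) * ((F.L : ℝ) ^ l)⁻¹)
        + (3 + 720 * (F.L : ℝ) ^ 2) * ((28800 * (F.L : ℝ) ^ 4 * ((∑ x : Site (F.P K) 0, ∑ μ : Fin (F.P K).d, ∑ ν : Fin (F.P K).d,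
            (if μ < ν then ∑ j : Fin 2, ∑ k : Fin 2,
              ‖(curl (torusT (F.P K) 0) (fun κ z => unitsField (toUField W) ⟨z, κ⟩) (fun κ z => pertVar W (emb15 W (expHermField D)) ⟨z, κ⟩) μ ν x) j k‖ ^ 2 else 0)) + (∑ x : Site (F.P K) 0, ∑ j : Fin 2, ∑ k : Fin 2,
            ‖(divB (torusT (F.P K) 0) (fun κ z => unitsField (toUField W) ⟨z, κ⟩) (fun κ z => pertVar W (emb15 W (expHermField D)) ⟨z, κ⟩) x) j k‖ ^ 2))
            + 600000 * (F.L : ℝ) ^ 4 * (((F.L : ℝ) ^ (K - n)) ^ 2)⁻¹ * (∑ b : PBond (F.P K) 0, ‖pertVar W (emb15 W (expHermField D)) b‖ ^ 2)) * (F.L : ℝ) ^ l) := by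
  have heL' := window_weak F he heL
  have hUe := plaq_le_of_regPr F n K hreg
  obtain ⟨-, hμ⟩ := chartSups F n K he heL hs0 hs4 hsL hreg D hD hs
  obtain ⟨-, hμ0, hμ72, hμN, hμθ, hθ0, hθL⟩ := supNumerals F n K hs0 hsL
  exact sum_normSq_twistedLevelRatio_le_LOnly_T3 F n K W (emb15 W (expHermField D)) he heL' hUe (fun j : ℕ => 480 * (F.L : ℝ) ^ 4 * (F.L : ℝ) ^ j * s) hμ0 hμ hμ72 hμN hθ0 hμθ hθL

end Summit.QuantumFields.YangMills.Theorems.Prop7TwistedLevelMassOfRegPr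

end
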